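import Summits.Ventures.WeilGRH.TwistCert32DataCells
import HarnessLib

/-!
# Twisted moment certificate `twistCert32` (χ mod 3, χ(2) = −1): kernel check of the cells, chunk 1

Cell `rh-explicit`, WEIL TRACK — GRH ARM (namespace `Summit.Ventures.WeilGRH`).  Twisted moment-method certificate `twistCert32 : TwistCert`
(`TwistedMomentCert.lean`) for the Dirichlet characters `χ` mod `3` with `χ(2) = −1` at `a₀ = b = 563/1024 ≥ (log 3)/2`: level `wL`,
`T = 50`, `N = 99` (`nb = 50`), `prec = 72`, `j = 5`, the Legendre blocks `C`, `D` and the digamma parts of the 145 cells of the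
tree's `ζ` base-rung certificate `weilCert3C` (`Literature/…/WeilFirstPrimeCertificateDataC*.lean`) RE-USED; new: the ripple claims for
the sign `s = -1`, the shifted scaled moment table (`pnu = 64`), the dyadic PSD factors `U`, `ellLo = -50706850929/1099511627776` (`≤ log 3 − log π`).
Generated by exact rational arithmetic mirroring the checker (session folder `work/gen/gen_twist.py`; `λ_min(S'_even) ≈ 9.286e-03`,
`λ_min(S'_odd) ≈ 7.231e-01` in floating point; exact dominance slack 4.643e-03 / 3.616e-01).  Nothing about the
data is trusted: the rung theorem consumes only the kernel-evaluated Booleans `checkCellsZS` / `TwistCert.checkAlg`. Pure proof file.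
-/

noncomputable section

open Literature.NumberTheory.LFunctions

namespace Summit.Ventures.WeilGRH

set_option maxHeartbeats 0 in
/-- **Kernel check of the cells, chunk 1** of `twistCert32` (twisted integer checker `FPDCell.checkZS (-1) 72 5`). [folklore] -/
theorem checkCellsChunk1_twist32 :
    (twist32Cells1.all fun c ↦ FPDCell.checkZS (-1) 72 5 c) = true := by
  decide +kernel

end Summit.Ventures.WeilGRH

end
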